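import Literature.NumberTheory.Automorphic.AdicCompletionIntegersAdicComplete   -- ★ `integer_valuation_eq_valuedInteger`, ★ `instValuativeRelAdicCompletion`
import HarnessLib

/-!
# The two spellings of the valuation ring `𝒪[K_v]` of an adic completion — `Valued.integer K_v` and `(ValuativeRel.valuation K_v).integer` — and the
# transport of units (`IsUnit 2`, `IsUnit n`, `IsUnit x`) between them
(Serre, *Local Fields* (1979), Ch. II §1: the valuation ring of a complete discretely valued field)

Topic `NumberTheory/Automorphic`; namespace `Literature.NumberTheory.Automorphic`.  THEOREMS ONLY (no def, no instance, no notation, no named fact, no `sorry`).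

WHY.  Mathlib offers the notation `𝒪[K]` twice: `open scoped Valued` makes it `Valued.integer K = (Valued.v).integer`, `open scoped ValuativeRel` makes it
`(ValuativeRel.valuation K).integer`.  On `K_v = v.adicCompletion K` (valuative relation ★ `instValuativeRelAdicCompletion` = the one of `Valued.v`) the two
are EQUAL subrings (★ `integer_valuation_eq_valuedInteger`) but not reducibly so: a hypothesis `IsUnit (2 : 𝒪[K_v])` elaborated in one dialect does not
`exact`-close a goal elaborated in the other (definitional unfolding of the two valuations diverges).  The unitary-group files of the tree use both dialects
(e.g. the Shalika pay-down skeleton and ★ `UnipotentOrbitalMeasuresExistCM` — `ValuativeRel`; ★ `UnitaryThreeUnipotentStrataCM`, ★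
`UnitaryThreeUnipotentClosedFiltrationCM` — `Valued`), so the glue needs the transport ONCE, as named lemmas:
* `mem_valuationInteger_iff_mem_valuedInteger` — membership;
* `isUnit_valuationInteger_mk_iff` — a general element `⟨x, _⟩` is a unit in one ring iff in the other;
* `isUnit_natCast_valuationInteger_iff`, `isUnit_ofNat_valuationInteger_iff` — numerals (`Nat.cast` and `OfNat` forms);
* `isUnit_two_valuedInteger_of_isUnit_two`, `isUnit_two_valuationInteger_of_isUnit_two` — the `2 ∈ 𝒪^×` binder of the odd-place statements, both ways.
All are one-liners over the ring isomorphism `RingEquiv.subringCongr (integer_valuation_eq_valuedInteger K v)`.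

## References
* [SerreLocalFields1979] J.-P. Serre, *Local Fields*, GTM 67 (1979), Ch. II §1.
-/

noncomputable section

namespace Literature.NumberTheory.Automorphic

open IsDedekindDomain

variable {R : Type*} [CommRing R] [IsDedekindDomain R] (K : Type*) [Field K] [Algebra R K] [IsFractionRing R K] (v : HeightOneSpectrum R)

/-- Membership in the two spellings of `𝒪[K_v]` agrees: `x ∈ (ValuativeRel.valuation K_v).integer ↔ x ∈ Valued.integer K_v`.
[cite: SerreLocalFields1979, Ch. II §1] -/
theorem mem_valuationInteger_iff_mem_valuedInteger (x : v.adicCompletion K) :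
    x ∈ (ValuativeRel.valuation (v.adicCompletion K)).integer ↔ x ∈ Valued.integer (v.adicCompletion K) := by
  rw [integer_valuation_eq_valuedInteger K v]

/-- The ring isomorphism between the two spellings is the identity on underlying elements. [cite: SerreLocalFields1979, Ch. II §1] -/
theorem coe_subringCongr_integer_valuation (x : (ValuativeRel.valuation (v.adicCompletion K)).integer) :
    ((RingEquiv.subringCongr (integer_valuation_eq_valuedInteger K v) x : Valued.integer (v.adicCompletion K)) : v.adicCompletion K) = x := rfl

/-- **Element transport**: `⟨x, _⟩` is a unit of `(ValuativeRel.valuation K_v).integer` iff it is a unit of `Valued.integer K_v`. [cite: SerreLocalFields1979, Ch. II §1] -/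
theorem isUnit_valuationInteger_mk_iff (x : v.adicCompletion K) (hx : x ∈ (ValuativeRel.valuation (v.adicCompletion K)).integer)
    (hx' : x ∈ Valued.integer (v.adicCompletion K)) :
    IsUnit (⟨x, hx⟩ : (ValuativeRel.valuation (v.adicCompletion K)).integer) ↔ IsUnit (⟨x, hx'⟩ : Valued.integer (v.adicCompletion K)) := by
  have h : RingEquiv.subringCongr (integer_valuation_eq_valuedInteger K v) ⟨x, hx⟩ = ⟨x, hx'⟩ := Subtype.ext rfl
  rw [← h, isUnit_map_iff]

/-- **Numerals, `Nat.cast` form**: `(n : (ValuativeRel.valuation K_v).integer)` is a unit iff `(n : Valued.integer K_v)` is. [cite: SerreLocalFields1979, Ch. II §1] -/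
theorem isUnit_natCast_valuationInteger_iff (n : ℕ) :
    IsUnit (n : (ValuativeRel.valuation (v.adicCompletion K)).integer) ↔ IsUnit (n : Valued.integer (v.adicCompletion K)) := by
  rw [← map_natCast (RingEquiv.subringCongr (integer_valuation_eq_valuedInteger K v)) n, isUnit_map_iff]

/-- **Numerals, `OfNat` form** (the shape `IsUnit (2 : 𝒪[K_v])` elaborates to): for a numeral `n ≥ 2`, `IsUnit (n : (ValuativeRel.valuation K_v).integer) ↔
IsUnit (n : Valued.integer K_v)`. [cite: SerreLocalFields1979, Ch. II §1] -/
theorem isUnit_ofNat_valuationInteger_iff (n : ℕ) [n.AtLeastTwo] :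
    IsUnit (OfNat.ofNat n : (ValuativeRel.valuation (v.adicCompletion K)).integer) ↔ IsUnit (OfNat.ofNat n : Valued.integer (v.adicCompletion K)) := by
  rw [← map_ofNat (RingEquiv.subringCongr (integer_valuation_eq_valuedInteger K v)) n, isUnit_map_iff]

/-- **`2 ∈ 𝒪[K_v]^×`, `ValuativeRel` spelling ⇒ `Valued` spelling** — the direction a leaf written under `open scoped ValuativeRel` needs to feed an organ written
under `open scoped Valued`. [cite: SerreLocalFields1979, Ch. II §1] -/
theorem isUnit_two_valuedInteger_of_isUnit_two (h : IsUnit (2 : (ValuativeRel.valuation (v.adicCompletion K)).integer)) :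
    IsUnit (2 : Valued.integer (v.adicCompletion K)) :=
  (isUnit_ofNat_valuationInteger_iff K v 2).1 h

/-- **`2 ∈ 𝒪[K_v]^×`, `Valued` spelling ⇒ `ValuativeRel` spelling.** [cite: SerreLocalFields1979, Ch. II §1] -/
theorem isUnit_two_valuationInteger_of_isUnit_two (h : IsUnit (2 : Valued.integer (v.adicCompletion K))) :
    IsUnit (2 : (ValuativeRel.valuation (v.adicCompletion K)).integer) :=
  (isUnit_ofNat_valuationInteger_iff K v 2).2 h

/-- The `2 ∈ 𝒪[K_v]^×` binder, as an `Iff`. [cite: SerreLocalFields1979, Ch. II §1] -/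
theorem isUnit_two_valuationInteger_iff :
    IsUnit (2 : (ValuativeRel.valuation (v.adicCompletion K)).integer) ↔ IsUnit (2 : Valued.integer (v.adicCompletion K)) :=
  isUnit_ofNat_valuationInteger_iff K v 2

end Literature.NumberTheory.Automorphic
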